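import Literature.MathematicalPhysics.QuantumFieldTheory.BalabanImbrieJaffe1984to88.BIJ88Eq5145CornerW6Loc
import Literature.MathematicalPhysics.QuantumFieldTheory.BalabanImbrieJaffe1984to88.BIJ88Ineq5144OneCube

/-!
# `BalabanImbrieJaffe1984to88.BIJ88Eq5145HeadMultiCube` — T. Bałaban, J. Imbrie, A. Jaffe, *Effective action and cluster properties of the
abelian Higgs model*, Commun. Math. Phys. **114** (1988) 257–315 [BalabanImbrieJaffe1988], Sect. 5.14, (5.14.5) p. 312 [PDF 56] with (5.14.4)
p. 309 [PDF 53]: **THE C2.Eq5.14.5 HEAD THEOREM OF RECORD WITH ITS LEAF HYPOTHESIS (5.14.4) REDUCED TO THE MULTI-CUBE POLYMERS `|X_β| ≥ 2`** — the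
one-cube part `|X_β| = 1` of the located leaf being a THEOREM in the `e_k`-small regime (`BIJ88Ineq5144OneCube`, this seat gen 15).

statement-level skeleton of published theorems with citation tags; proofs where landed; nothing here is a claim about the Yang–Mills mass gap

p. 309, verbatim: *"Let us drop the prime, and prove that |g₃(H_β, X_β)| ≤ (e^β(L^kε/ε₀)^{1/4−α})^{[|H_β| + β′|X_β∖H_β|]}. (5.14.4) … The proof of this
estimate is similar to the one for g₂. We mention only the new features. … The bound for H_β = ∅, |X_β| = 1 was obtained for g₂, and the same proof
applies here."*  PDF held: `paper:balaban1988-cmp114-bij-abelian-higgs-effective-action` (journal page = PDF page + 256); pp. 309, 312 = PDF 53,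
56 read this generation.

WHAT IS REPRODUCED (unit `lit-balaban-p36`, generation 15 of the Phase-2 proof seat p36; SKELETON row **C2.Eq5.14.5** member cell of
`HOME/lit-balaban-r16/ROWS-C2-part2.md` — a candidate refinement of the head of record `BIJ88Eq5145CornerW6Loc.eq5145_zG_mod_W6v_of_ineq5144_loc`
(p36 g14, p330573), owner r16 (the head pointer is r16's call); row **C2.Eq5.14.3-5.14.4** member).  ONE theorem, **`eq5145_zG_mod_W6v_of_ineq5144_two_le`**:
the conclusion of the head of record VERBATIM, its hypothesis `h5144` (r16's typed leaf `Ineq5144` in the located reading for the data of every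
sub-region `X′ ⊆ Λ₁₂` of every admissible region at every `t ∈ (0,1]` and every assignment) REPLACED by (i) its part on the polymers with at least two
cubes, `h5144two : … ∀ H X″, 2 ≤ |X″| → |locAct … H X″| ≤ θ^{|H| + β′|X″ ∖ loc(H)|}` — the inductive cluster-expansion decay, the genuinely unproved
printed claim — and (ii) the one-cube regime of `BIJ88Ineq5144OneCube.ineq5144_locAct_iff_two_le` (an all-orders derivative constant `Ĉ` for orders
`≤ n̄+1`, one-cube sub-Gaussian tails of the slot fields `law(□_i){a ≤ |Φ_b|} ≤ Ae^{−κa²}`, terms `|V(Y)| ≤ K_Y ≤ K₁`, `≤ G` slots per cube, and the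
five `e_k`-smallness / interaction-smallness inequalities).  Proof: the head of record applied to `h5144` reassembled by `ineq5144_locAct_iff_two_le`
(empty polymer: activity `0`; one cube: the theorem; `≥ 2` cubes: `h5144two`).
HONEST SCOPE: exactly the head of record's scope with clause C1 («the leaf (5.14.4) in the located reading») narrowed to the multi-cube polymers; the
other clauses (`h311`/`W₆″`, `hmod`, the `(n̄+1)!` slip G-C2-p36-06, gen 5's regime, the finite-dimensional §5.13 model with bounded terms) unchanged;
measurability of the slot fields follows from `hmod`.  0 `sorry`, 0 definitions, 0 `Prop` facts (D-0026); imports `BIJ88Eq5145CornerW6Loc` (p36 g14)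
and `BIJ88Ineq5144OneCube` (p36 g15); modifies nothing.  NOT summit progress; NOT continuum; NOT Clay.  Cell `lit-balaban` Phase 2, seat p36 gen 15
(owner r16, referee ref-5).
-/

noncomputable section

open Finset MeasureTheory
open Literature.MathematicalPhysics.QuantumFieldTheory.BalabanImbrieJaffe1984to88
open BIJ88DirichletForms305 (interpForm)
open BIJ88PolymerRep5134 (g1 IsAdmissible corner)
open BIJ88PolymerRep5134Gauss (ext expect zG)
open BIJ88Resummation5141 (outer lam12)
open BIJ88Resummation5141Adm (lam12')
open BIJ88Expansion5143 (g3 prime)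
open BIJ88Expansion5143Gauss (fD)
open BIJ88Expansion5143Ordered (polysOf cvsupp locv wv)
open BIJ88ConnectedGraphResummation (Tsum)
open BIJ88SlotMomentsGauss308 (uD fieldLaw)
open BIJ88Sect2Statements (pLog)
open BIJ88Sect5Statements (CutoffProfile cutoff)
open BIJ88Sect5StatementsPart4 (remR pertP)
open BIJ88Eq5145CornerModel
open BIJ88Eq5145CornerUrsell (cubeIn)
open BIJ88W6PrimeVsupp (actIn W6v)
open BIJ88Ineq5144Located (locAct)
open BIJ88GaussShellModulus309 (continuous_and_zero_of_mod)
open BIJ88Eq5145CornerW6Loc (eq5145_zG_mod_W6v_of_ineq5144_loc)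
open BIJ88Ineq5144OneCube (ineq5144_locAct_iff_two_le)

namespace Literature.MathematicalPhysics.QuantumFieldTheory.BalabanImbrieJaffe1984to88.BIJ88Eq5145HeadMultiCube

variable {α I : Type} [Fintype α] [DecidableEq α] [Fintype I] [DecidableEq I]
  (blk : α → I) (Δ : Matrix α α ℝ) (ℱ : α → ℝ)
variable (adj : I → I → Prop) [DecidableRel adj]
variable (χ : CutoffProfile) {ι υ : Type*} [DecidableEq ι] [DecidableEq υ]
variable {p ek : ℝ} {B : Finset ι} {Φ : ι → (α → ℝ) → ℝ} {c : ι → ℝ} {Ys : Finset υ} {V : υ → (α → ℝ) → ℝ}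
variable (cube : ↥B ⊕ ↥Ys → I) {L : Type*} (γ : L → ↥B ⊕ ↥Ys)

/-- **(5.14.5) ON THE MODEL — THE HEAD OF RECORD WITH (5.14.4) ASSUMED ON THE MULTI-CUBE POLYMERS ONLY** (p. 312 (5.14.5); p. 309 (5.14.4):
*"The proof of this estimate is similar to the one for g₂ … The bound for H_β = ∅, |X_β| = 1 was obtained for g₂, and the same proof applies here"*):
the conclusion of `BIJ88Eq5145CornerW6Loc.eq5145_zG_mod_W6v_of_ineq5144_loc` verbatim (`exp[−𝒫^L − Σ_X (W₆′(X) + W₆″(X))]`, `W₆′` as printed), from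
its hypotheses with `h5144` replaced by `h5144two` — the located leaf on the polymers `X″` with `2 ≤ |X″|` only, for the data of every sub-region of
`Λ₁₂` of every admissible region, every `t ∈ (0,1]`, every assignment — together with the one-cube regime of `BIJ88Ineq5144OneCube` (all-orders
derivative constant `Ĉ` for orders `≤ n̄+1`; one-cube tails `A, κ`; `K_Y ≤ K₁`; `≤ G` slots per cube; `e_k ≤ θ`, `n̄ + 2 ≤ κ(81/100)c₀²|log e_k⁻¹|^{2p−1}`,
`Ĉ^{n̄+1}Ae^{GK₁}e_k ≤ 1`, `K_Y e^{GK₁} ≤ θ`, `e^{GK₁}GAe_k + (e^{GK₁} − 1) ≤ θ^{β′}`).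
[cite: BalabanImbrieJaffe1988, (5.14.5) p.312; (5.14.4) p.309; p.310 display 4; p.311] -/
theorem eq5145_zG_mod_W6v_of_ineq5144_two_le [Fintype ι] [Fintype υ] {nbr : I → Finset I} {D : ℕ} {θ β' : ℝ}
    (hR : ∀ x y, adj x y → adj y x) (hD : ∀ x, (nbr x).card ≤ D) (hnbr : ∀ x y, adj x y → y ∈ nbr x) (hθ0 : 0 < θ) (hθ1 : θ ≤ 1)
    (hβ : 0 ≤ β') (hsmall : 16 * ((D : ℝ) + 1) ^ 2 * (θ ^ (β' / 2) * Real.exp 2) ≤ 1)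
    (hΔadj : ∀ x y, blk x ≠ blk y → ¬ adj (blk x) (blk y) → Δ x y = 0) (hΔ : Δ.PosDef)
    (hχ : ∀ x, 0 ≤ χ.χ₁ x) (hp : 1 / 2 < p)
    (hmod : ∀ b ∈ B, ∃ ℓ₁ ℓ₂ : (α → ℝ) → ℝ, IsLinearMap ℝ ℓ₁ ∧ IsLinearMap ℝ ℓ₂ ∧
      ((∀ φ, Φ b φ = ℓ₁ φ) ∨ (∀ φ, Φ b φ = Real.sqrt (ℓ₁ φ ^ 2 + ℓ₂ φ ^ 2))))
    {c₀ : ℝ} (hc₀ : 0 < c₀) (hcb : ∀ b ∈ B, c₀ ≤ c b) (hV : ∀ Y ∈ Ys, Measurable (V Y)) {KY : υ → ℝ} (hK : ∀ Y ∈ Ys, ∀ φ, |V Y φ| ≤ KY Y)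
    (hek : 0 < ek) (hek1 : ek < Real.exp (-1))
    (hΦloc : ∀ b : B, ∀ φ ψ : α → ℝ, (∀ x, blk x = cube (Sum.inl b) → φ x = ψ x) → Φ b φ = Φ b ψ)
    (hVloc : ∀ Y : Ys, ∀ φ ψ : α → ℝ, (∀ x, blk x = cube (Sum.inr Y) → φ x = ψ x) → V Y φ = V Y ψ)
    (F : I → (α → ℝ) → ℝ) (hFloc : ∀ i (φ ψ : α → ℝ), (∀ x, blk x = i → φ x = ψ x) → F i φ = F i ψ)
    {L' : Type} [Fintype L'] [DecidableEq L'] {nbar : ℕ} (hL : Fintype.card L' = nbar + 1)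
    (W Bl : Finset I) (Vconst PL : ℝ) (W6pp : Finset (Finset I) → Finset I → ℝ)
    -- the one-cube regime of `BIJ88Ineq5144OneCube`
    {C : ℝ} (hC1 : 1 ≤ C)
    (hC : ∀ i, i ≤ nbar + 1 → ∀ (A : ℝ) ⦃q e t : ℝ⦄, q ≠ 0 → 0 < e → 0 < t → t * e ≤ Real.exp (-1) →
      |iteratedDeriv i (fun s => cutoff χ (q * pLog p (s * e)) A) t| ≤ C * t ^ (-(i : ℤ)))
    {K₁ : ℝ} (hK₁0 : 0 ≤ K₁) (hK₁ : ∀ Y ∈ Ys, KY Y ≤ K₁) {G : ℕ} (hG : ∀ i, (univ.filter fun τ : ↥B ⊕ ↥Ys => cube τ = i).card ≤ G)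
    {A κ : ℝ} (hA : 0 ≤ A) (hκ : 0 ≤ κ)
    (htail : ∀ (i : I) (b : ↥B), cube (Sum.inl b) = i → ∀ a : ℝ, 0 ≤ a →
      (fieldLaw blk Δ ℱ {i}).real {ω | a ≤ |Φ b (ext blk {i} ω)|} ≤ A * Real.exp (-(κ * a ^ 2)))
    (hekθ : ek ≤ θ) (hreg : ((nbar + 1 : ℕ) : ℝ) + 1 ≤ κ * (81 / 100) * c₀ ^ 2 * Real.log ek⁻¹ ^ (2 * p - 1))
    (hpre : C ^ (nbar + 1) * A * Real.exp (G * K₁) * ek ≤ 1) (hKθ : ∀ Y ∈ Ys, KY Y * Real.exp (G * K₁) ≤ θ)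
    (hvac : Real.exp (G * K₁) * G * A * ek + (Real.exp (G * K₁) - 1) ≤ θ ^ β')
    -- (5.14.4) on the polymers with at least two cubes, located reading, for the data of every sub-region of `Λ₁₂` at every `t ∈ (0,1]`
    (h5144two : ∀ ρ ∈ (outer W Bl).filter (IsAdmissible adj), ∀ X' ⊆ lam12 W ρ, ∀ t ∈ Set.Ioc (0 : ℝ) 1,
      ∀ γ' : L' → ↥(slotB B Ys cube X') ⊕ ↥(slotY B Ys cube X'), ∀ (H : Finset L') (X'' : Finset I), 2 ≤ X''.card →
        |locAct (cubeIn cube X' ∘ γ') (actIn blk Δ ℱ adj χ p ek B Φ c Ys V cube (lam12' adj W ρ) X' t γ') H X''| ≤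
          θ ^ ((H.card : ℝ) + β' * ((X'' \ H.image (cubeIn cube X' ∘ γ')).card : ℝ)))
    (h311 : ∀ ρ ∈ (outer W Bl).filter (IsAdmissible adj),
      Vconst + pertP (fun t => Real.log (ztIn blk Δ ℱ χ p ek B Φ c Ys V cube (lam12 W ρ) (lam12' adj W ρ) t)) nbar =
        PL + ∑ X' : Finset I, W6pp ρ X') :
    Real.exp (-Vconst) * expect blk Δ ℱ (fun i φ => fD (uD χ p ek B Φ c Ys V 1) cube γ ∅ i φ * F i φ) W (corner ℝ W) =
      ∑ ρ ∈ (outer W Bl).filter (IsAdmissible adj),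
        (∏ X ∈ ρ, g1 adj (zG blk Δ ℱ (fun i φ => fD (uD χ p ek B Φ c Ys V 1) cube γ ∅ i φ * F i φ)) X) *
          (zG blk Δ ℱ (fun i φ => fD (uD χ p ek B Φ c Ys V 1) cube γ ∅ i φ * F i φ) (lam12 W ρ) (lam12' adj W ρ) /
              zG blk Δ ℱ (fD (uD χ p ek B Φ c Ys V 1) cube γ ∅) (lam12 W ρ) (lam12' adj W ρ) *
            Real.exp (-PL - ∑ X' : Finset I,
              (W6v blk Δ ℱ adj χ p ek B Φ c Ys V cube (lam12' adj W ρ) (lam12 W ρ) L' nbar X' + W6pp ρ X'))) := by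
  have hΦm : ∀ b ∈ B, Measurable (Φ b) := fun b hb => by
    obtain ⟨ℓ₁, ℓ₂, h₁, h₂, h⟩ := hmod b hb
    exact (continuous_and_zero_of_mod h₁ h₂ h).1.measurable
  exact eq5145_zG_mod_W6v_of_ineq5144_loc blk Δ ℱ adj χ cube γ hR hD hnbr hθ0 hθ1 hβ hsmall hΔadj hΔ hχ hp hmod hc₀ hcb hV hK hek hek1 hΦloc
    hVloc F hFloc hL W Bl Vconst PL W6pp
    (fun ρ hρ X' hX' t ht γ' =>
      (ineq5144_locAct_iff_two_le blk Δ ℱ adj χ cube hp hC1 hC hΔ hχ hc₀ hcb hΦm hV hK hK₁0 hK₁ hG hA hκ htail hek hek1.le hekθ hreg hpre hKθ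
        hvac (lam12' adj W ρ) X' ht (by rw [hL]) γ').2 (h5144two ρ hρ X' hX' t ht γ'))
    h311

end Literature.MathematicalPhysics.QuantumFieldTheory.BalabanImbrieJaffe1984to88.BIJ88Eq5145HeadMultiCube

end
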